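import Summits.CriticalPhenomena.Ising3DConformalLimit.Theorems.EnergyNotSigmaSquaredRungOneAdjacentMergingAbstractHarvestCases
import Mathlib.Analysis.SpecificLimits.Basic
import HarnessLib

/-!
# Abstract share harvest, part 3: the registered stub `stub_abstractHarvest`
(line `dominant-shell-concentration`, crux `RungOneAdjacentMerging`, item stmt-CriticalPhenomena-11262;
lead prover-line-stmt-CriticalPhenomena-11262-0)

From parts 1–2b (`…AbstractHarvestAux`, `…AbstractHarvestBlocks`, `…AbstractHarvestCases`): SELECTION of one windowed scale from
every other block of the greedy decay-separation chain gives decay-separated windowed families with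
unbounded share (`harvest_select`); a pigeonhole on residues modulo `L` (`2 ≤ τ·2^L`) adds the index
separation `2^{k+1} ≤ τ·2^ℓ` (`harvest_index_separate`); the block sequence and the block maxima are
constructed by `Nat.find` and `Finset.sup'` inside the proof of `stub_abstractHarvest`, whose window
constant is `A = 2^128`.
-/

noncomputable section

open Finset Filter
open scoped BigOperators

namespace Summit.CriticalPhenomena.Ising3DConformalLimit.RungOneAdjacentMergingDominantShell

variable {a B : ℕ → ℝ} {sh : ℕ → ℝ} {W : ℕ → Prop} {τ : ℝ} {m : ℕ → ℕ} {μ : ℕ → ℝ}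

/-- A parity class of `range n` carries at least half of a nonnegative sum. [folklore] -/
theorem harvest_parity_half {f : ℕ → ℝ} (n : ℕ) (M : ℝ)
    (hM : 2 * M ≤ ∑ i ∈ range n, f i) :
    ∃ Q : Finset ℕ, Q ⊆ range n ∧ (∀ i ∈ Q, ∀ j ∈ Q, i < j → i + 2 ≤ j) ∧ M ≤ ∑ i ∈ Q, f i := by
  classical
  have hsplit := Finset.sum_filter_add_sum_filter_not (range n) (fun i => i % 2 = 0) f
  by_cases hc : M ≤ ∑ i ∈ (range n).filter (fun i => i % 2 = 0), f i
  · refine ⟨(range n).filter (fun i => i % 2 = 0), Finset.filter_subset _ _, ?_, hc⟩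
    intro i hi j hj hij
    simp only [Finset.mem_filter] at hi hj
    omega
  · refine ⟨(range n).filter (fun i => ¬ i % 2 = 0), Finset.filter_subset _ _, ?_, by linarith⟩
    intro i hi j hj hij
    simp only [Finset.mem_filter] at hi hj
    omega

/-- SELECTION: decay-separated families of windowed scales (`≥ m 0`) with share sum as large as
desired — one scale attaining the block maximum from every other block. [folklore] -/
theorem harvest_select (h : HarvestData a B)
    (hsh : ∀ k, sh k = 8 ^ k * a (k + 2) ^ 2 / B (k + 1))
    (hW : ∀ k, W k ↔ a (k - 4) ≤ (2 : ℝ) ^ 128 * a (k + 4)) (hτ : 0 < τ) (hτ1 : τ ≤ 1 / 2)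
    (hm : Blocks a τ m) (hμ : BlockMax sh W m μ) (M : ℝ) :
    ∃ 𝒦 : Finset ℕ, (∀ k ∈ 𝒦, m 0 ≤ k ∧ W k) ∧
      (∀ k ∈ 𝒦, ∀ ℓ ∈ 𝒦, k < ℓ → a (ℓ - 2) ≤ τ * a (k + 2)) ∧ M ≤ ∑ k ∈ 𝒦, sh k := by
  classical
  obtain ⟨n, hn⟩ := harvest_blockMax_unbounded h hsh hW hτ hτ1 hm hμ (2 * M)
  obtain ⟨Q, hQsub, hQgap, hQsum⟩ := harvest_parity_half n M hn
  -- witnesses of the positive maxima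
  set Q' := Q.filter (fun i => μ i ≠ 0) with hQ'
  have hwit : ∀ i ∈ Q', ∃ k, m i ≤ k ∧ k < m (i + 1) ∧ W k ∧ sh k = μ i := by
    intro i hi
    simp only [hQ', Finset.mem_filter] at hi
    rcases hμ.wit i with h0 | hk
    · exact absurd h0 hi.2
    · exact hk
  set sel : ℕ → ℕ := fun i =>
    if hi : ∃ k, m i ≤ k ∧ k < m (i + 1) ∧ W k ∧ sh k = μ i then Classical.choose hi else 0 with hsel
  have hsel_spec : ∀ i ∈ Q', m i ≤ sel i ∧ sel i < m (i + 1) ∧ W (sel i) ∧ sh (sel i) = μ i := by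
    intro i hi
    have hex := hwit i hi
    simp only [hsel, dif_pos hex]
    exact Classical.choose_spec hex
  -- block index is recovered from the selected scale
  have hinj_aux : ∀ i ∈ Q', ∀ j ∈ Q', sel i ≤ sel j → i ≤ j := by
    intro i hi j hj hij
    obtain ⟨hi1, hi2, -, -⟩ := hsel_spec i hi
    obtain ⟨hj1, hj2, -, -⟩ := hsel_spec j hj
    exact hm.index_le hi1 hj2 hij
  have hinj : Set.InjOn sel Q' := by
    intro i hi j hj hij
    exact le_antisymm (hinj_aux i hi j hj hij.le) (hinj_aux j hj i hi hij.ge)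
  refine ⟨Q'.image sel, ?_, ?_, ?_⟩
  · intro k hk
    rw [Finset.mem_image] at hk
    obtain ⟨i, hi, rfl⟩ := hk
    obtain ⟨hi1, -, hWi, -⟩ := hsel_spec i hi
    exact ⟨(hm.le_of_le (Nat.zero_le i)).trans hi1, hWi⟩
  · intro k hk ℓ hℓ hkℓ
    rw [Finset.mem_image] at hk hℓ
    obtain ⟨i, hi, rfl⟩ := hk
    obtain ⟨j, hj, rfl⟩ := hℓ
    obtain ⟨hi1, hi2, -, -⟩ := hsel_spec i hi
    obtain ⟨hj1, hj2, -, -⟩ := hsel_spec j hj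
    have hij : i < j := by
      have h1 := hinj_aux i hi j hj hkℓ.le
      rcases h1.lt_or_eq with h | rfl
      · exact h
      · exact absurd hkℓ (lt_irrefl _)
    have hgap : i + 2 ≤ j :=
      hQgap i (Finset.mem_of_mem_filter i hi) j (Finset.mem_of_mem_filter j hj) hij
    have hstart := hm.start
    have hm2 : m (i + 2) ≤ m j := hm.le_of_le hgap
    have hm10 : 10 ≤ m (i + 2) := hstart.trans (hm.le_of_le (Nat.zero_le _))
    calc a (sel j - 2) ≤ a (m (i + 2) - 2) := h.a_anti (by omega)
      _ = a (m (i + 1 + 1) - 2) := rfl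
      _ ≤ τ * a (m (i + 1) + 2) := hm.compat (i + 1)
      _ ≤ τ * a (sel i + 2) := mul_le_mul_of_nonneg_left (h.a_anti (by omega)) hτ.le
  · rw [Finset.sum_image hinj]
    have hsum' : ∑ i ∈ Q', sh (sel i) = ∑ i ∈ Q', μ i :=
      Finset.sum_congr rfl fun i hi => (hsel_spec i hi).2.2.2
    rw [hsum']
    have hQQ : ∑ i ∈ Q, μ i = ∑ i ∈ Q', μ i := by
      rw [← Finset.sum_filter_add_sum_filter_not Q (fun i => μ i ≠ 0) μ]
      have h0 : ∑ i ∈ Q.filter (fun i => ¬ μ i ≠ 0), μ i = 0 :=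
        Finset.sum_eq_zero fun i hi => by
          simp only [Finset.mem_filter, not_not] at hi
          exact hi.2
      rw [h0, add_zero]
    rw [← hQQ]
    exact hQsum

/-- INDEX SEPARATION by pigeonhole: if `2 ≤ τ·2^L` (`L ≥ 1`), a family with share sum `≥ L·M`
(`M ≥ 0`) contains a residue class modulo `L` with share sum `≥ M`, inside which `k < ℓ` forces
`2^{k+1} ≤ τ·2^ℓ`. [folklore] -/
theorem harvest_index_separate {L : ℕ} (hL : 1 ≤ L) (hτ : 0 < τ) (hτL : 2 ≤ τ * 2 ^ L)
    (𝒦 : Finset ℕ) {M : ℝ} (hsum : L * M ≤ ∑ k ∈ 𝒦, sh k) :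
    ∃ 𝒦' : Finset ℕ, 𝒦' ⊆ 𝒦 ∧
      (∀ k ∈ 𝒦', ∀ ℓ ∈ 𝒦', k < ℓ → (2 : ℝ) ^ (k + 1) ≤ τ * 2 ^ ℓ) ∧ M ≤ ∑ k ∈ 𝒦', sh k := by
  classical
  have hfib : ∑ r ∈ range L, ∑ k ∈ 𝒦.filter (fun k => k % L = r), sh k = ∑ k ∈ 𝒦, sh k :=
    Finset.sum_fiberwise_of_maps_to (fun k _ => Finset.mem_range.2 (Nat.mod_lt k (by omega))) _
  have hpig : ∃ r ∈ range L, M ≤ ∑ k ∈ 𝒦.filter (fun k => k % L = r), sh k := by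
    apply Finset.exists_le_of_sum_le (Finset.nonempty_range_iff.2 (by omega))
    rw [hfib, Finset.sum_const, Finset.card_range, nsmul_eq_mul]
    exact hsum
  obtain ⟨r, -, hr⟩ := hpig
  refine ⟨𝒦.filter (fun k => k % L = r), Finset.filter_subset _ _, ?_, hr⟩
  intro k hk ℓ hℓ hkℓ
  simp only [Finset.mem_filter] at hk hℓ
  have hmod : (ℓ - k) % L = 0 := by
    rw [← Nat.sub_mod_eq_zero_of_mod_eq (hℓ.2.trans hk.2.symm)]
  have hdvd : L ∣ ℓ - k := Nat.dvd_of_mod_eq_zero hmod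
  have hLle : L ≤ ℓ - k := Nat.le_of_dvd (by omega) hdvd
  have hpow : (2 : ℝ) ^ ℓ ≥ 2 ^ k * 2 ^ L := by
    rw [← pow_add]
    exact pow_le_pow_right₀ (by norm_num) (by omega)
  have h2k : 0 ≤ (2 : ℝ) ^ k := by positivity
  calc (2 : ℝ) ^ (k + 1) = 2 ^ k * 2 := pow_succ _ _
    _ ≤ 2 ^ k * (τ * 2 ^ L) := mul_le_mul_of_nonneg_left hτL h2k
    _ = τ * (2 ^ k * 2 ^ L) := by ring
    _ ≤ τ * 2 ^ ℓ := mul_le_mul_of_nonneg_left hpow hτ.le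

/-- **STUB 5b of the line `dominant-shell-concentration` — THE ABSTRACT SHARE HARVEST** (lead's stub):
for sequences `a, B` with `HarvestData a B` there is ONE window constant (`A = 2^128`) such that for
every `τ > 0`, floor `k₀` and target `M` some finite family of scales `≥ k₀` is `A`-windowed, pairwise
τ-decay-separated and index-separated, and carries share `Σ 8^k a(k+2)²/B(k+1) ≥ M`.  Proof: parts 1–3
(ancestor lemma and divergence of the windowed shares; greedy decay-separation chain, block maxima and
their unboundedness; selection from alternate blocks and pigeonhole on residues), with the chain built by
`Nat.find` from `a → 0` and the maxima by `Finset.sup'`. [folklore] -/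
theorem stub_abstractHarvest :
    ∀ a B : ℕ → ℝ, HarvestData a B →
      ∃ A : ℝ, 1 ≤ A ∧ ∀ τ : ℝ, 0 < τ → ∀ (k₀ : ℕ) (M : ℝ), ∃ 𝒦 : Finset ℕ,
        (∀ k ∈ 𝒦, k₀ ≤ k ∧ a (k - 4) ≤ A * a (k + 4)) ∧
        (∀ k ∈ 𝒦, ∀ ℓ ∈ 𝒦, k < ℓ → a (ℓ - 2) ≤ τ * a (k + 2) ∧ (2 : ℝ) ^ (k + 1) ≤ τ * 2 ^ ℓ) ∧
        M ≤ ∑ k ∈ 𝒦, (8 : ℝ) ^ k * a (k + 2) ^ 2 / B (k + 1) := by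
  intro a B h
  refine ⟨(2 : ℝ) ^ 128, by norm_num, ?_⟩
  intro τ hτ k₀ M
  classical
  -- the working decay factor τ' = min τ (1/2)
  set τ' : ℝ := min τ (1 / 2) with hτ'def
  have hτ' : 0 < τ' := lt_min hτ (by norm_num)
  have hτ'1 : τ' ≤ 1 / 2 := min_le_right _ _
  have hτ'τ : τ' ≤ τ := min_le_left _ _
  set sh : ℕ → ℝ := fun k => (8 : ℝ) ^ k * a (k + 2) ^ 2 / B (k + 1) with hshdef
  have hsh : ∀ k, sh k = 8 ^ k * a (k + 2) ^ 2 / B (k + 1) := fun k => rfl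
  set W : ℕ → Prop := fun k => a (k - 4) ≤ (2 : ℝ) ^ 128 * a (k + 4) with hWdef
  have hW : ∀ k, W k ↔ a (k - 4) ≤ (2 : ℝ) ^ 128 * a (k + 4) := fun k => Iff.rfl
  have hnn := harvest_share_nonneg h hsh
  -- the greedy chain exists since a → 0
  have hnext : ∀ n : ℕ, ∃ ℓ, n + 4 < ℓ ∧ a (ℓ - 2) ≤ τ' * a (n + 2) := by
    intro n
    have hpos : 0 < τ' * a (n + 2) := mul_pos hτ' (h.a_pos _)
    have hev := h.a_tendsto.eventually (gt_mem_nhds hpos)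
    rw [Filter.eventually_atTop] at hev
    obtain ⟨J, hJ⟩ := hev
    refine ⟨max J (n + 5) + 2, by omega, ?_⟩
    rw [Nat.add_sub_cancel]
    exact (hJ _ (le_max_left _ _)).le
  obtain ⟨m, hm, hm0⟩ : ∃ m : ℕ → ℕ, Blocks a τ' m ∧ m 0 = max k₀ 10 := by
    let ms : ℕ → ℕ := fun i => Nat.rec (max k₀ 10) (fun _ mi => Nat.find (hnext mi)) i
    have hms0 : ms 0 = max k₀ 10 := rfl
    have hmsS : ∀ i, ms (i + 1) = Nat.find (hnext (ms i)) := fun i => rfl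
    refine ⟨ms, ⟨by rw [hms0]; exact le_max_right _ _, fun i => ?_, fun i => ?_, fun i ℓ h1 h2 => ?_⟩, hms0⟩
    · rw [hmsS]; exact (Nat.find_spec (hnext (ms i))).1
    · rw [hmsS]; exact (Nat.find_spec (hnext (ms i))).2
    · rw [hmsS] at h2
      have := Nat.find_min (hnext (ms i)) h2
      push Not at this
      exact this h1
  -- block maxima
  obtain ⟨μ, hμ⟩ : ∃ μ : ℕ → ℝ, BlockMax sh W m μ := by
    let S : ℕ → Finset ℕ := fun i => (Ico (m i) (m (i + 1))).filter W
    let μs : ℕ → ℝ := fun i => if hS : (S i).Nonempty then (S i).sup' hS sh else 0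
    have hmem : ∀ i k, m i ≤ k → k < m (i + 1) → W k → k ∈ S i := fun i k h1 h2 h3 => by
      simp only [S, Finset.mem_filter, Finset.mem_Ico]; exact ⟨⟨h1, h2⟩, h3⟩
    refine ⟨μs, ⟨fun i => ?_, fun i k h1 h2 h3 => ?_, fun i => ?_⟩⟩
    · simp only [μs]
      split_ifs with hS
      · obtain ⟨k, hk, hkeq⟩ := Finset.exists_mem_eq_sup' hS sh
        rw [hkeq]; exact hnn k
      · exact le_rfl
    · have hk := hmem i k h1 h2 h3
      have hS : (S i).Nonempty := ⟨k, hk⟩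
      simp only [μs, dif_pos hS]
      exact Finset.le_sup' sh hk
    · simp only [μs]
      split_ifs with hS
      · right
        obtain ⟨k, hk, hkeq⟩ := Finset.exists_mem_eq_sup' hS sh
        simp only [S, Finset.mem_filter, Finset.mem_Ico] at hk
        exact ⟨k, hk.1.1, hk.1.2, hk.2, hkeq.symm⟩
      · left; rfl
  -- the index-separation modulus L: 2 ≤ τ'·2^L
  obtain ⟨L, hL⟩ : ∃ L : ℕ, 2 / τ' < (2 : ℝ) ^ L := pow_unbounded_of_one_lt _ (by norm_num)
  have hτL : 2 ≤ τ' * 2 ^ L := by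
    rw [div_lt_iff₀ hτ'] at hL; linarith
  have hL1 : 1 ≤ L := by
    rcases Nat.eq_zero_or_pos L with rfl | hpos
    · norm_num at hτL; linarith
    · exact hpos
  -- selection and pigeonhole
  set M₀ : ℝ := max M 0 with hM₀
  obtain ⟨𝒦₁, h𝒦₁W, h𝒦₁sep, h𝒦₁sum⟩ :=
    harvest_select h hsh hW hτ' hτ'1 hm hμ (L * M₀)
  obtain ⟨𝒦, h𝒦sub, h𝒦idx, h𝒦sum⟩ := harvest_index_separate hL1 hτ' hτL 𝒦₁ h𝒦₁sum
  refine ⟨𝒦, fun k hk => ?_, fun k hk ℓ hℓ hkℓ => ⟨?_, ?_⟩, (le_max_left _ _).trans h𝒦sum⟩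
  · obtain ⟨hk0, hWk⟩ := h𝒦₁W k (h𝒦sub hk)
    exact ⟨by rw [hm0] at hk0; exact (le_max_left _ _).trans hk0, hWk⟩
  · calc a (ℓ - 2) ≤ τ' * a (k + 2) := h𝒦₁sep k (h𝒦sub hk) ℓ (h𝒦sub hℓ) hkℓ
      _ ≤ τ * a (k + 2) := mul_le_mul_of_nonneg_right hτ'τ (h.a_pos _).le
  · calc (2 : ℝ) ^ (k + 1) ≤ τ' * 2 ^ ℓ := h𝒦idx k hk ℓ hℓ hkℓ
      _ ≤ τ * 2 ^ ℓ := mul_le_mul_of_nonneg_right hτ'τ (by positivity)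

end Summit.CriticalPhenomena.Ising3DConformalLimit.RungOneAdjacentMergingDominantShell

end
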